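import Summits.AtomisticToContinuum.Crystallization.Theorems.ContactSaturationLadderSparseCut

/-!
# ContactSaturationLadderSparseCut — PART B (lines 228–350 of lens-1 g34 `land/ContactSaturationLadderSparseCut.lean`,
# sha256 8eb9f06912371e8673d477c2e909aad4937de9a4938ece956412bf513fe78345; split at the section-header boundaries for the 400-line rule, ONE namespace, linear import chain A → B → C;
# landed byte-identical in the declarations by prover hand 1, gen 11, --supports stmt-AtomisticToContinuum-30303)

§45.2 — the chunk-removal kernel (cut and paste), `Competitor`, `competitor_of_cluster`, `competitor_eighth`.
-/

noncomputable section

namespace Summit.AtomisticToContinuum.Crystallization.Theorems.ContactSaturationLadderSparseCut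

section SparseCut45


open scoped BigOperators Classical
open Metric Filter
open Literature.MathematicalPhysics.StatisticalMechanics (lennardJones IsGroundState interactionEnergy groundStateEnergy
  groundStateEnergy_lennardJones_le subadditive_groundStateEnergy_lennardJones sum_inv_pow_six_le)
open Summit.AtomisticToContinuum.Crystallization.Theorems.ContactSaturationLadderHaloCount (voidAdjSet)
open Summit.AtomisticToContinuum.Crystallization.Theorems.ContactSaturationLadderChunkDoor (NoLooseChunks SiteMarker gs_separated
  seven_tenths_le_gsMinDist cube_le_eight_mul_card_of_voidFree)
open Summit.AtomisticToContinuum.Crystallization.Theorems.ContactSaturationLadderToleranceFloor (UniformlyTightF looseSetF NoLooseChunkAtF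
  NoLooseChunksF BandChunkAtF BandExclusionF bandExclusionF_of_noLooseChunksF noLooseChunksF_mono noLooseChunksF_of_noLooseChunks
  looseSetF_anti_slack noLooseChunksF_iff_band noLooseChunksF_of_band)
open Summit.AtomisticToContinuum.Crystallization.Theorems.CrystalliteDichotomyCutPasteLaw (pairSum_add_two_mul_cross_le_groundStateEnergy)

/-! ### §45.2 The chunk-removal kernel (cut and paste): ONE GS-free inequality opens UNMARKED(F) -/

/-- **`ChunkRemovalFloor F α D`** — THE ANALYTIC TARGET [GS-free · `N`-uniform · one inequality]: in every injective `7/10`-separated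
configuration, the particles `A = B(c,2r)` (`r ≥ 2`) of a 2-void-free, `F`-FREE doubled window satisfy the removal floor
`D_A + 2·I_A ≥ −(2α·#A + D·r²)`, where `D_A = Σ_{a,b∈A} V(d_ab)` and `I_A = Σ_{a∈A, b∉A} V(d_ab)` (so `D_A + 2I_A = 2(E_in + E_cross)` is
twice the energy released by removing the chunk). -/
def ChunkRemovalFloor (F : SiteMarker) (α D : ℝ) : Prop :=
  ∀ (N : ℕ) (y : Fin N → EuclideanSpace ℝ (Fin 3)), Function.Injective y →
    (∀ i j : Fin N, i ≠ j → (7 : ℝ) / 10 ≤ dist (y i) (y j)) →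
      ∀ (c : EuclideanSpace ℝ (Fin 3)) (r : ℝ), 2 ≤ r →
        (∀ i : Fin N, dist (y i) c ≤ 2 * r → i ∉ voidAdjSet 2 y) →
          (∀ i : Fin N, dist (y i) c ≤ 2 * r → i ∉ F N y) →
            -(2 * α * ((Finset.univ.filter fun i : Fin N => dist (y i) c ≤ 2 * r).card : ℝ) + D * r ^ 2) ≤
              ∑ a ∈ (Finset.univ.filter fun i : Fin N => dist (y i) c ≤ 2 * r),
                  ∑ b ∈ (Finset.univ.filter fun i : Fin N => dist (y i) c ≤ 2 * r), lennardJones (dist (y a) (y b)) +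
                2 * ∑ a ∈ (Finset.univ.filter fun i : Fin N => dist (y i) c ≤ 2 * r),
                  ∑ b ∈ (Finset.univ.filter fun i : Fin N => dist (y i) c ≤ 2 * r)ᶜ, lennardJones (dist (y a) (y b))

/-- **`Competitor γ`** — a competitor energy density `γ`: `E(n) ≤ (−γ + ε)·n` for all large `n`, every `ε > 0`
(equivalently `e⋆ ≤ −γ`; ONE finite cluster certifies it, `competitor_of_cluster`; `competitor_eighth` from the tree's `E(4) = −1/2`). -/
def Competitor (γ : ℝ) : Prop :=
  ∀ ε : ℝ, 0 < ε → ∃ n₀ : ℕ, ∀ n : ℕ, n₀ ≤ n → groundStateEnergy lennardJones 3 n ≤ (-γ + ε) * n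

/-- A competitor density is monotone downwards. -/
theorem competitor_mono {γ γ' : ℝ} (hγ : γ' ≤ γ) (h : Competitor γ) : Competitor γ' := by
  intro ε hε
  obtain ⟨n₀, hn₀⟩ := h ε hε
  refine ⟨n₀, fun n hn => (hn₀ n hn).trans ?_⟩
  have : (0 : ℝ) ≤ n := Nat.cast_nonneg n
  nlinarith

/-- **A competitor density from ONE finite cluster** (Fekete/subadditivity, TREE `subadditive_groundStateEnergy_lennardJones` +
Mathlib `Subadditive.eventually_div_lt_of_div_lt`): `E(n₁) ≤ −γ·n₁` for a single `n₁ ≥ 1` gives `Competitor γ`.  This is the door for a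
CERTIFIED competitor: a kernel-checked energy evaluation of one explicit cluster (an fcc ball) certifies its `γ`. -/
theorem competitor_of_cluster {n₁ : ℕ} (hn₁ : n₁ ≠ 0) {γ : ℝ} (h : groundStateEnergy lennardJones 3 n₁ ≤ -(γ * n₁)) :
    Competitor γ := by
  intro ε hε
  have hsub := subadditive_groundStateEnergy_lennardJones (d := 3) (by norm_num)
  have hn₁pos : (0 : ℝ) < n₁ := by exact_mod_cast Nat.pos_of_ne_zero hn₁
  have hL : groundStateEnergy lennardJones 3 n₁ / n₁ < -γ + ε := by
    rw [div_lt_iff₀ hn₁pos]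
    nlinarith
  obtain ⟨n₀, hn₀⟩ := Filter.eventually_atTop.mp (hsub.eventually_div_lt_of_div_lt hn₁ hL)
  refine ⟨max n₀ 1, fun n hn => ?_⟩
  have hn1 : 1 ≤ n := le_trans (le_max_right _ _) hn
  have hnpos : (0 : ℝ) < n := by exact_mod_cast hn1
  have h1 := hn₀ n (le_trans (le_max_left _ _) hn)
  rw [div_lt_iff₀ hnpos] at h1
  exact h1.le

/-- … or from one explicit injective configuration (`groundStateEnergy_lennardJones_le`). -/
theorem competitor_of_config {n₁ : ℕ} (hn₁ : n₁ ≠ 0) {z : Fin n₁ → EuclideanSpace ℝ (Fin 3)} (hz : Function.Injective z) {γ : ℝ}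
    (h : interactionEnergy lennardJones z ≤ -(γ * n₁)) : Competitor γ :=
  competitor_of_cluster hn₁ ((groundStateEnergy_lennardJones_le hz).trans h)

/-- **The interface is inhabited by a TREE theorem**: `Competitor (1/8)` from `E(4) = −1/2` (the unit tetrahedron,
`Literature.Barriers.AtomisticToContinuum.groundStateEnergy_lennardJones_four`, file `IcosahedralClusters`).  [The tree also yields `Competitor (1/2)`
from the unit fcc trial state of the Mie ladder at `q = 6` (`MieRungCoordination.eventually_groundStateEnergy_div_le_ladder`, `miePotential_six`;
proof text in the lens folder `g34/bc/competitor_half_g34.lean`, whose import chain is not yet built on the farm), and numerically `e⋆ ≈ −0.7175`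
gives every `γ < 0.7175`.] -/
theorem competitor_eighth : Competitor (1 / 8) :=
  competitor_of_cluster (n₁ := 4) (by norm_num)
    (by rw [Literature.Barriers.AtomisticToContinuum.groundStateEnergy_lennardJones_four]; norm_num)

/-- **KERNEL B · `unmarkedChunkExclusion_of_floor`** (cut and paste, TREE `CrystalliteDichotomyCutPasteLaw.pairSum_add_two_mul_cross_le_groundStateEnergy`
+ filling `cube_le_eight_mul_card_of_voidFree`): a removal floor at rate `α` for the marker `F` and a competitor density `γ > α` give the
looseness-free exclusion UNMARKED(F) with the explicit radius `r₀ = max (2n₀+2) (8D/(γ−α) + 1)` (no sign condition on `D`). -/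
theorem unmarkedChunkExclusion_of_floor {F : SiteMarker} {α D γ : ℝ} (hF : ChunkRemovalFloor F α D) (hK : Competitor γ)
    (hαγ : α < γ) : UnmarkedChunkExclusion F := by
  obtain ⟨n₀, hn₀⟩ := hK ((γ - α) / 2) (by linarith)
  refine ⟨max (2 * (n₀ : ℝ) + 2) (8 * D / (γ - α) + 1), fun r hr N y hy c hv hFree i => ?_⟩
  have hr1 : 2 * (n₀ : ℝ) + 2 ≤ r := le_trans (le_max_left _ _) hr
  have hr2 : 8 * D / (γ - α) + 1 ≤ r := le_trans (le_max_right _ _) hr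
  have hn₀nn : (0 : ℝ) ≤ n₀ := Nat.cast_nonneg n₀
  have hr2' : 2 ≤ r := by linarith
  by_contra hin
  rw [not_lt] at hin
  set A : Finset (Fin N) := Finset.univ.filter fun j : Fin N => dist (y j) c ≤ 2 * r with hA
  -- filling: r³ ≤ 8·#B(c,r) ≤ 8·#A
  have hfill : r ^ 3 ≤ 8 * ((Finset.univ.filter fun j : Fin N => dist (y j) c ≤ r).card : ℝ) :=
    cube_le_eight_mul_card_of_voidFree hr2' hv ⟨i, hin⟩
  have hsub : (Finset.univ.filter fun j : Fin N => dist (y j) c ≤ r) ⊆ A := by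
    intro j hj
    rw [hA]
    simp only [Finset.mem_filter, Finset.mem_univ, true_and] at hj ⊢
    linarith
  have hcardle : (((Finset.univ.filter fun j : Fin N => dist (y j) c ≤ r).card : ℕ) : ℝ) ≤ (A.card : ℝ) := by
    exact_mod_cast Finset.card_le_card hsub
  have hAfill : r ^ 3 ≤ 8 * (A.card : ℝ) := hfill.trans (by linarith)
  -- #A ≥ n₀
  have hAn₀ : n₀ ≤ A.card := by
    have h1 : ((n₀ : ℝ) + 1) ^ 3 ≤ (r / 2) ^ 3 := pow_le_pow_left₀ (by linarith) (by linarith) 3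
    have h2 : (n₀ : ℝ) + 1 ≤ ((n₀ : ℝ) + 1) ^ 3 := by
      have h3 : (1 : ℝ) ≤ (n₀ + 1) ^ 2 := by nlinarith
      nlinarith
    have h4 : (r / 2) ^ 3 = r ^ 3 / 8 := by ring
    have h5 : (n₀ : ℝ) + 1 ≤ A.card := by linarith
    exact_mod_cast (by linarith : (n₀ : ℝ) ≤ A.card)
  -- cut and paste + competitor
  have hcut := pairSum_add_two_mul_cross_le_groundStateEnergy hy A
  have hcomp := hn₀ A.card hAn₀
  -- removal floor
  have hsep : ∀ i j : Fin N, i ≠ j → (7 : ℝ) / 10 ≤ dist (y i) (y j) := fun i j hij =>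
    seven_tenths_le_gsMinDist.trans (gs_separated hy i j hij)
  have hfloor := hF N y hy.1 hsep c r hr2' hv hFree
  -- combine: (γ − α)·#A ≤ D r² but #A ≥ r³/8 and r > 8D/(γ−α)
  have hγα : 0 < γ - α := by linarith
  have hkey : (γ - α) * (A.card : ℝ) ≤ D * r ^ 2 := by nlinarith
  have hr0 : 0 < r := by linarith
  have h6 : (γ - α) * r ^ 3 ≤ 8 * D * r ^ 2 := by nlinarith
  have h7 : (γ - α) * r ≤ 8 * D := by
    have hr2pos : 0 < r ^ 2 := by positivity
    have : (γ - α) * r * r ^ 2 ≤ 8 * D * r ^ 2 := by nlinarith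
    exact le_of_mul_le_mul_right this hr2pos
  have h8 : 8 * D / (γ - α) < r := by linarith
  rw [div_lt_iff₀ hγα] at h8
  nlinarith

/-- **UNMARKED(F;δ) from ONE inequality and a competitor**: the route-side piece at every tolerance. -/
theorem unmarkedChunkExclusionF_of_floor {F : SiteMarker} {α D γ : ℝ} (hF : ChunkRemovalFloor F α D) (hK : Competitor γ)
    (hαγ : α < γ) (δ : ℝ) : UnmarkedChunkExclusionF F δ :=
  unmarkedChunkExclusionF_of_unmarkedChunkExclusion F δ (unmarkedChunkExclusion_of_floor hF hK hαγ)

end SparseCut45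

end Summit.AtomisticToContinuum.Crystallization.Theorems.ContactSaturationLadderSparseCut
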